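/-
Copyright (c) 2026 the pub-hodgecm-mathlib formalisation cell (harness21).  Prover seat hodgecm-mathlib-K2E1-p13 (g6), Track B ∕ K2-LIT, h413 = `stmt-HodgeConjecture-24833`,
R90-TF section S8 «ContSpec-n½», S8 dealer R90-CS-plan (g4) S8-R270 (1): THE (V-1) SCALAR-SUB-ROW `hsrc` ASSEMBLER — ED. 16's basis-free `hsrc` binder at the base point `ι_f b₁`, in the
re-keyed currency `(S, T′) := (places over S₀, S₀)` (J-S8-SRC (M2)), FROM ★ p864821 `hsrc_of_record_at_basePoint_of_core` ∘ ★ p865238 (M3) ∘ §1 (twisted-CT glue) ∘ ★ p865258 (M1′),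
with the witness-side letters `hΦ hEis hgood hψ hres hΦfc hΦfM` DISCHARGED and ★ p864821's LOCAL letters `hωc hω1 hωS₀ hΩ hin hsp` kept (LIVE ∕ STRUCT, K2E1-p11's ledger f14602fa).
-/
import Summits.HodgeConjecture.HodgeConjecture.Theorems.K2E1ChiMidBlockUnfoldingOfRecordU3             -- ★ p864821 (R90-CS-p03): `hsrc_of_record_at_basePoint_of_core`, §1 tokens `isUnitary_quadraticHeckeCharCM_mul_self`, `bcηInv_mul_ideleBaseChange_eq`; brings ★ p864662 `unfoldingHaarConst`, `unfoldingArchPhase`, `unfoldingBadPlaces`, `hgood_unfoldingBadPlaces`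
import Summits.HodgeConjecture.HodgeConjecture.Theorems.R90S8MidWitnessSrc16OfCTQuotientU3              -- ★ p865258 (this seat, (M1′)): `hsrc16_of_ctQuotient_at_basePoint`
import Summits.HodgeConjecture.HodgeConjecture.Theorems.R90S8MidWitnessPairIdentificationU3             -- ★ p865238 (this seat, (M3)): `untwisted_mul_detChar_eq_pairWitness`
import Summits.HodgeConjecture.HodgeConjecture.Theorems.R90S8ChiSectionPairLevelOfRecordStructureU3     -- ★ p864141 (K2E1-p11): `apply_eq_archSectionE_mul_apply_finAdelicToAdelic` (structure theorem at the level of record)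
import Summits.HodgeConjecture.HodgeConjecture.Theorems.K2E1ChiDetCharBorelU3                           -- ★ FILE A (R90-C133-p02): `isChiSectionPair_mul_detChar`
import Summits.HodgeConjecture.HodgeConjecture.Theorems.K2E1ChiEisensteinDetTwistU2                     -- ★ (R90-C133-p02): `eisensteinSeriesU_flatSectionU_mul_automorphicCharacter`, `borelConstantTerm_mul_automorphicCharacter`
import HarnessLib

/-!
# R90-TF · S8 «ContSpec-n½» — `R90S8MidWitnessSrc16OfCoreLettersU3`: THE (V-1) SCALAR-SUB-ROW `hsrc` ASSEMBLER — ED. 16's `hsrc` at `ι_f b₁` from ★ p864821's core, modulo its LOCAL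
# letters only

Cell `hodgecm-mathlib`, crux H413 (`stmt-HodgeConjecture-24833`, lane `--supports … --as helper`), route of record `HCCMUnconditional`; R90-TF section S8, socket (V)
`sock_S8_res_midBlock_ne_bot` (B ED. 7 :358), SCALAR SUB-ROW (V-1) (J-S8-M3′), head ★ p865157 `resGMidBlock_ne_bot_of_record_v16` → ED. 17 (K2E1-p15 (g5): `hm1` + (M2) re-key).  THEOREMS
ONLY (no `def`, no `instance`, no `notation`, no named-fact hypothesis, no `sorry`; default heartbeats); count-neutral; CLOSES NO SOCKET (OF-RECORD composition).

THE CHAIN (S8-R270 (1) «★ p864821 ∘ ★ p865238 ∘ §1 ∘ ★ p865258»).  Let `χ := ξ.bcη⁻¹·μω`, `Θ := ψ∘det = detChar ξ.ψ`, `φ₀` the keeper's witness in `V(χ; levelOfRecord K_f, ω^{χ,1})` (so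
`φ₀(g) = Φa^{χ,1}(g_∞)·φ₀(ι_f g_f)`, ★ structure theorem), `Ec₀` its tube continuation, `ι_f b₁ ∈ K` the base point, `|m_w| = 1` (`hm1`, so the exponents of record are
`p = q = 0`: `((±1−1)∕2).toNat = 0 = ((∓1−1)∕2).toNat`).  (1) ★ p864821 at the PAIR witness `Φ^{p,q}_∞(g_∞)·Φf^{pair}(g_f)`, `Φf^{pair} := (φ₀∘ι_f)·(Θ∘ι_f)`, `p q :=` the exponents of
record, `Ec := Ec₀·Θ`: its witness letters are DISCHARGED — `hΦ` (★ `isChiSectionPair_mul_detChar` on `φ₀·Θ`, which IS that witness by ★ p865238 `untwisted_mul_detChar_eq_pairWitness` and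
`p = q = 0`), `hEis` (★ `eisensteinSeriesU_flatSectionU_mul_automorphicCharacter` + `hEis₀`), `hΦfc hΦfM` (`|Θ| = 1`), `hψ hres` (★ §1 of p864821 from `hμω`), `hφ := hμu`'s `φ_ξ`-form
`hφu` — giving `(CT(Ec₀·Θ)(ι_f b₁) − (φ₀Θ)(ι_f b₁)·H^z)∕H^{2−z} = C₀·∏_{v∈S₀}(…)·∫∫(ε := unfoldingArchPhase ξ, m := kμ − 2eη, p, q)·c_{S₀}(z)` (`C₀ := unfoldingHaarConst …`).  (2) §1
`hct_of_pairUnfolding` (★ `borelConstantTerm_mul_automorphicCharacter`): the left side is `Θ(ι_f b₁)·(CT(Ec₀ z)(ι_f b₁) − φ₀(ι_f b₁)H^z)∕H^{2−z}`.  (3) ★ p865258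
`hsrc16_of_ctQuotient_at_basePoint` with `θ := Θ(ι_f b₁)`, `A :=` ED. 16's lambda at `C := C₀`, `ε := unfoldingArchPhase ξ`, `c := c_{S₀}`: ED. 16's `hsrc` BYTES at `g₁ := ι_f b₁`
in the re-keyed currency.
* §1 **`hct_of_pairUnfolding`** — the twisted-CT glue (S).
* §2 **`hsrc16_of_coreLetters_at`** — the assembler at ANY good finset `S₀` (`hgood` a binder) modulo ★ p864821's local letters `hωc hω1 hωS₀ hΩ hin hsp` on ONE weight binder `ω`.
* §3 HEAD **`hsrc16_of_coreLetters`** — the same at `S₀ := unfoldingBadPlaces hδ h𝔫` with `hgood` DISCHARGED (★ `hgood_unfoldingBadPlaces` from `hφ𝔫 :` «conductor of `φ_ξ` divides `𝔫`»).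
HONEST DEVIATION (S8-R270 (1) asked `hin` discharged in-file): `hin`'s ★ discharge (★ `hin_of_torusEntries` ∘ ★ p865184 `exists_goodInert_weight` (i)) needs `ω` FIXED at the inert good
places — the same act as fixing `ω` at the split places ((d), LIVE) —; with `ω` a binder the only in-file form is a STRUCT clause «`ω_v` = p865184's weight», no gain; it drops together
with `hsp hω1 hΩ hωc` in K2E1-p11's ω-definition edition (their `hsrc_letterFree_at_basePoint`), which then feeds §2∕§3 here verbatim.
HONEST LABEL: HC_CM is proved only modulo the 7 printed citations (2 remaining named inputs: hLiu418 = `stmt-HodgeConjecture-24832`, h413 = `stmt-HodgeConjecture-24833`) until rung 0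
closes; REL ≠ ★ ≠ BUILT; this assembler serves the (V-1) scalar sub-row only (`hm1`); visible = frame + `hm1` + `hφu` + witness facts (`hφ₀V hφ₀c hφ₀M hEis₀ hb₁`) + level (`h𝔫 hφ𝔫`) + ★
p864821's six local letters; asserts no named fact and closes no socket; count-neutral.

## References
* [MoeglinWaldspurger1995] C. Mœglin, J.-L. Waldspurger, *Spectral Decomposition and Eisenstein Series* (1995), II.1.6–II.1.7, IV.1.11.
* [Rogawski1990] J. D. Rogawski, *Automorphic Representations of Unitary Groups in Three Variables* (1990), §12.2 p. 174, §13.3 p. 202, §13.9 p. 229.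
* [TateThesis1967] J. Tate, *Fourier analysis in number fields and Hecke's zeta-functions* (1967), Thm 3.3.1.
* [BorelJacquet1979] A. Borel, H. Jacquet, *Automorphic forms and automorphic representations*, PSPM 33.1 (1979), §4.1.
-/

set_option autoImplicit false
set_option linter.dupNamespace false  -- the mandated namespace `…HodgeConjecture.HodgeConjecture.R90.S8` (LEAD #1 L1) repeats the summit's segment

noncomputable section

open MeasureTheory MeasureTheory.Measure Filter Topology Set NumberField NumberField.InfinitePlace IsDedekindDomain
open scoped NNReal ENNReal ComplexConjugate
open Literature.NumberTheory Literature.NumberTheory.Automorphic Literature.NumberTheory.Automorphic.UnitaryGroup Literature.NumberTheory.GaloisRepresentations AdelicGroupData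
open Literature.NumberTheory.GaloisRepresentations.IsNonarchimedeanLocalField Literature.NumberTheory.LFunctions
open Literature.NumberTheory.Automorphic.Arthur2013.Leaves.TECR Literature.MeasureTheory.Group Literature.NumberTheory.Rogawski1990
open Literature.NumberTheory.Automorphic.UnitaryGroup.AdelicCharactersDetQuasiSplit (antidiagonal_over_det_ne_zero)
open Summit.HodgeConjecture.HodgeConjecture.Cruxes.H413
open Summit.HodgeConjecture.HodgeConjecture.Cruxes.H413.K2E1BorelEisensteinU
open Summit.HodgeConjecture.HodgeConjecture.Cruxes.H413.K2E1BLBorelSpacesU2Defs Summit.HodgeConjecture.HodgeConjecture.Cruxes.H413.K2E1BLBorelOperatorsU2Defs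
open Summit.HodgeConjecture.HodgeConjecture.Cruxes.H413.K2E1CharacterEisensteinU2Defs
open Summit.HodgeConjecture.HodgeConjecture.Cruxes.H413.K2E1ChiSectionSpaceU2Defs
open Summit.HodgeConjecture.HodgeConjecture.Cruxes.H413.K2E1CharacterEisensteinU3PairDefs
open Summit.HodgeConjecture.HodgeConjecture.Cruxes.H413.K2E1ChiSectionSpaceU3PairDefs
open Summit.HodgeConjecture.HodgeConjecture.Cruxes.H413.K2E1ChiMidBlockUnfoldingOfRecordU3 (hsrc_of_record_at_basePoint_of_core isUnitary_quadraticHeckeCharCM_mul_self bcηInv_mul_ideleBaseChange_eq)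
open Summit.HodgeConjecture.HodgeConjecture.Cruxes.H413.K2E1ChiUnfoldingConstantsOfRecordU3 (unfoldingHaarConst unfoldingArchPhase unfoldingBadPlaces hgood_unfoldingBadPlaces)
open Summit.HodgeConjecture.HodgeConjecture.Cruxes.H413.K2E1ChiDetCharBorelU3 (isChiSectionPair_mul_detChar)
open Summit.HodgeConjecture.HodgeConjecture.Cruxes.H413.K2E1ChiEisensteinDetTwistU2 (eisensteinSeriesU_flatSectionU_mul_automorphicCharacter borelConstantTerm_mul_automorphicCharacter)

namespace Summit.HodgeConjecture.HodgeConjecture.R90.S8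

variable (L : Type) [Field L] [NumberField L] [IsCMField L]

/-! ## §1 The twisted-CT glue -/

/-- **`hct_of_pairUnfolding` — THE TWISTED-CT GLUE**: `CT(E·Θ) = CT(E)·Θ` for an automorphic character `Θ` (★ `borelConstantTerm_mul_automorphicCharacter`), so an identity for the CT quotient
of the TWISTED pair `(E·Θ, φ·Θ)` at `g₁` is `Θ(g₁)`-times the CT quotient of the untwisted pair `(E, φ)`. [cite: MoeglinWaldspurger1995, II.1.7] [cite: Rogawski1990, §13.3 p. 202] -/
theorem hct_of_pairUnfolding [MeasurableSpace (quasiSplit (↥(maximalRealSubfield L)) L (IsCMField.complexConj L) 3).Adelic] [BorelSpace (quasiSplit (↥(maximalRealSubfield L)) L (IsCMField.complexConj L) 3).Adelic]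
    (ν : Measure ↥(adelicUnipotent (↥(maximalRealSubfield L)) L (IsCMField.complexConj L) 3)) (𝓕 : Set ↥(adelicUnipotent (↥(maximalRealSubfield L)) L (IsCMField.complexConj L) 3))
    (Θ : (quasiSplit (↥(maximalRealSubfield L)) L (IsCMField.complexConj L) 3).AutomorphicCharacter) (E φ : (quasiSplit (↥(maximalRealSubfield L)) L (IsCMField.complexConj L) 3).Adelic → ℂ) (g₁ : (quasiSplit (↥(maximalRealSubfield L)) L (IsCMField.complexConj L) 3).Adelic) (z X : ℂ)
    (h : (borelConstantTerm ν 𝓕 (fun x => E x * ((Θ x : ℂˣ) : ℂ)) g₁ - φ g₁ * ((Θ g₁ : ℂˣ) : ℂ) * (((borelHeight g₁ : ℝ≥0) : ℝ) : ℂ) ^ z) / (((borelHeight g₁ : ℝ≥0) : ℝ) : ℂ) ^ (2 - z) = X) :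
    ((Θ g₁ : ℂˣ) : ℂ) * ((borelConstantTerm ν 𝓕 E g₁ - φ g₁ * (((borelHeight g₁ : ℝ≥0) : ℝ) : ℂ) ^ z) / (((borelHeight g₁ : ℝ≥0) : ℝ) : ℂ) ^ (2 - z)) = X := by
  rw [← h, borelConstantTerm_mul_automorphicCharacter L (by norm_num) ν 𝓕 Θ E g₁]
  ring

/-! ## §2 The assembler at any good finset `S₀` -/

/-- **`hsrc16_of_coreLetters_at` — ED. 16's `hsrc` AT `ι_f b₁`, RE-KEYED, FROM ★ p864821's CORE** (any good finset `S₀` with `hgood`; the witness-side letters discharged; ★ p864821's six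
local letters `hωc hω1 hωS₀ hΩ hin hsp` on one weight binder `ω`; scalar sub-row `hm1`).  See the module docstring for the chain. [cite: MoeglinWaldspurger1995, II.1.6–II.1.7, IV.1.11]
[cite: Rogawski1990, §13.9 p. 229] [cite: TateThesis1967, Thm 3.3.1] -/
theorem hsrc16_of_coreLetters_at
    (hcc : IsCMField.complexConj L * IsCMField.complexConj L = 1) (h2 : Module.finrank (↥(maximalRealSubfield L)) L = 2) (hc1 : IsCMField.complexConj L ≠ 1)
    {δ : L} (hcδ : IsCMField.complexConj L δ = -δ) (hδ : δ ≠ 0) {d : ↥(maximalRealSubfield L)} (hd : δ * δ = algebraMap ↥(maximalRealSubfield L) L d)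
    [MeasurableSpace (quasiSplit (↥(maximalRealSubfield L)) L (IsCMField.complexConj L) 3).Adelic] [BorelSpace (quasiSplit (↥(maximalRealSubfield L)) L (IsCMField.complexConj L) 3).Adelic]
    [MeasurableSpace (AdeleRing (𝓞 L) L)] [BorelSpace (AdeleRing (𝓞 L) L)]
    [MeasurableSpace (AdeleRing (𝓞 ↥(maximalRealSubfield L)) ↥(maximalRealSubfield L))] [BorelSpace (AdeleRing (𝓞 ↥(maximalRealSubfield L)) ↥(maximalRealSubfield L))]
    [MeasurableSpace (InfiniteAdeleRing L)] [BorelSpace (InfiniteAdeleRing L)]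
    [MeasurableSpace (InfiniteAdeleRing ↥(maximalRealSubfield L))] [BorelSpace (InfiniteAdeleRing ↥(maximalRealSubfield L))]
    [MeasurableSpace (FiniteAdeleRing (𝓞 L) L)] [BorelSpace (FiniteAdeleRing (𝓞 L) L)]
    [MeasurableSpace (FiniteAdeleRing (𝓞 ↥(maximalRealSubfield L)) ↥(maximalRealSubfield L))] [BorelSpace (FiniteAdeleRing (𝓞 ↥(maximalRealSubfield L)) ↥(maximalRealSubfield L))]
    [∀ v : HeightOneSpectrum (𝓞 ↥(maximalRealSubfield L)), MeasurableSpace (v.adicCompletion ↥(maximalRealSubfield L))] [∀ v : HeightOneSpectrum (𝓞 ↥(maximalRealSubfield L)), BorelSpace (v.adicCompletion ↥(maximalRealSubfield L))]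
    (ν : Measure ↥(adelicUnipotent ↥(maximalRealSubfield L) L (IsCMField.complexConj L) 3)) [ν.IsHaarMeasure]
    {𝓕 : Set ↥(adelicUnipotent ↥(maximalRealSubfield L) L (IsCMField.complexConj L) 3)} (h𝓕N : IsFundamentalDomain ↥(rationalUnipotent ↥(maximalRealSubfield L) L (IsCMField.complexConj L) 3) 𝓕 ν)
    (h𝓕c : IsCompact (closure 𝓕)) (h𝓕1 : ν 𝓕 = 1)
    (μE : Measure (AdeleRing (𝓞 L) L)) [μE.IsAddHaarMeasure] (μE₁ : Measure (InfiniteAdeleRing L)) [μE₁.IsAddHaarMeasure]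
    (μE₂ : Measure (FiniteAdeleRing (𝓞 L) L)) [μE₂.IsAddHaarMeasure]
    (μF : Measure (AdeleRing (𝓞 ↥(maximalRealSubfield L)) ↥(maximalRealSubfield L))) [μF.IsAddHaarMeasure] (μF₁ : Measure (InfiniteAdeleRing ↥(maximalRealSubfield L))) [μF₁.IsAddHaarMeasure]
    (μF₂ : Measure (FiniteAdeleRing (𝓞 ↥(maximalRealSubfield L)) ↥(maximalRealSubfield L))) [μF₂.IsAddHaarMeasure]
    (νv : ∀ v : HeightOneSpectrum (𝓞 ↥(maximalRealSubfield L)), Measure (v.adicCompletion ↥(maximalRealSubfield L))) [∀ v, (νv v).IsAddHaarMeasure]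
    -- the block of record: `μω` unitary of arch type `(kμ, 0)` restricting to `ε_{L∕L⁺}` (socket (V)'s `hμω`; `hφu` := ★ `isUnitary_bcηInv_mul L ξ hμu`); the SCALAR SUB-ROW `|m_w| = 1` (J-S8-M3′ `hm1`)
    (ξ : OneDimAutRepH L) {μω : HeckeCharacter L} (hφu : (ξ.bcη⁻¹ * μω).IsUnitary)
    (hμω : ∀ x : ideleGroup ↥(maximalRealSubfield L), μω (AdeleRing.ideleBaseChange (↥(maximalRealSubfield L)) L x) = quadraticHeckeCharCM L x)
    {kμ : InfinitePlace L → ℤ} (hμ : μω.HasUnitaryArchType kμ 0) (hm1 : ∀ w, kμ w - 2 * ξ.eη w = 1 ∨ kμ w - 2 * ξ.eη w = -1)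
    -- the UNTWISTED witness of record in its level-of-record block (the keeper's `φ₀ hφ₀V hφ₀c hφ₀M`), its tube continuation `Ec₀` (`hEis₀`), the base point `ι_f b₁ ∈ K`, the level `𝔫`
    {Kf : Subgroup ↥(finAdelic (↥(maximalRealSubfield L)) L (IsCMField.complexConj L) 3 ((StdForm.antidiagonal 3).over L))}
    {φ₀ : (quasiSplit (↥(maximalRealSubfield L)) L (IsCMField.complexConj L) 3).Adelic → ℂ}
    (hφ₀V : φ₀ ∈ chiSectionSpace (ξ.bcη⁻¹ * μω) (levelOfRecord L Kf) (omegaOfRecord L (ξ.bcη⁻¹ * μω) (1 : ↥(TorusDict.torus (IsCMField.complexConj L)) →ₜ* ℂˣ) Kf))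
    (hφ₀c : Continuous φ₀) {Mφ : ℝ} (hφ₀M : ∀ x, ‖φ₀ x‖ ≤ Mφ)
    (Ec₀ : ℂ → (quasiSplit (↥(maximalRealSubfield L)) L (IsCMField.complexConj L) 3).Adelic → ℂ) (hEis₀ : ∀ z : ℂ, 2 < z.re → Ec₀ z = eisensteinSeriesU (flatSectionU φ₀ z))
    {b₁ : ↥(finAdelic (↥(maximalRealSubfield L)) L (IsCMField.complexConj L) 3 ((StdForm.antidiagonal 3).over L))} (hb₁ : finAdelicToAdelic (↥(maximalRealSubfield L)) L (IsCMField.complexConj L) 3 ((StdForm.antidiagonal 3).over L) b₁ ∈ ((standardMaximalCompactGL 3 L).comap (adelicVal (↥(maximalRealSubfield L)) L (IsCMField.complexConj L) 3 ((StdForm.antidiagonal 3).over L)) : Subgroup (quasiSplit (↥(maximalRealSubfield L)) L (IsCMField.complexConj L) 3).Adelic))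
    (𝔫 : Ideal (𝓞 L))
    -- ★ p864821's LOCAL LETTERS at the pair finite reading `Φf^{pair} := (φ₀ ∘ ι_f)·(Θ ∘ ι_f)`: a good finset `S₀` (`hgood`), the weights `ω` — STRUCT `hωS₀`, LIVE `hωc hω1 hΩ hin hsp`
    (S₀ : Finset (HeightOneSpectrum (𝓞 ↥(maximalRealSubfield L))))
    (hgood : ∀ v ∉ S₀, (Algebra.IsUnramifiedIn (𝓞 L) v.asIdeal ∧ Valued.v (2 : v.adicCompletion ↥(maximalRealSubfield L)) = 1 ∧
        ∀ w : PlacesOver L v, Valued.v (algebraMap L (LocalRing L v) δ w) = 1) ∧ ∀ w : PlacesOver L v, (ξ.bcη⁻¹ * μω).IsUnramifiedAt w.1)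
    (ω : ∀ v : HeightOneSpectrum (𝓞 ↥(maximalRealSubfield L)), (Fin 3 → v.adicCompletion ↥(maximalRealSubfield L)) → ℂ)
    (hωc : ∀ z : ℂ, 2 < z.re → ∀ v, Continuous fun p : Fin 3 → v.adicCompletion ↥(maximalRealSubfield L) =>
        ω v p * (((∏ w' : PlacesOver L v, max 1 (max ((normAbs (w'.1.adicCompletion L) (quadraticLocalEquiv L v (IsCMField.complexConj L) hcδ hδ (p 0, p 1) w') : ℝ≥0) : ℝ)
            ((normAbs (w'.1.adicCompletion L) ((toLocalRing L v (p 2) * algebraMap L (LocalRing L v) δ -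
              toLocalRing L v 2⁻¹ * (quadraticLocalEquiv L v (IsCMField.complexConj L) hcδ hδ (p 0, p 1) *
                conjLocal L (IsCMField.complexConj L) v (quadraticLocalEquiv L v (IsCMField.complexConj L) hcδ hδ (p 0, p 1)))) w') : ℝ≥0) : ℝ))) : ℝ) : ℂ) ^ (-z))
    (hω1 : ∀ v ∉ S₀, ∀ p ∈ integralBox ↥(maximalRealSubfield L) (Fin 3) v, ω v p = 1)
    (hωS₀ : ∀ v ∈ S₀, ω v = Set.indicator {p : Fin 3 → v.adicCompletion ↥(maximalRealSubfield L) | p ∈ integralBox ↥(maximalRealSubfield L) (Fin 3) v ∧ ∀ w' : PlacesOver L v,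
              Valued.v (quadraticLocalEquiv L v (IsCMField.complexConj L) hcδ hδ (p 0, p 1) w') ≤ idealRadius L w'.1 𝔫 ∧
              Valued.v (conjLocal L (IsCMField.complexConj L) v (quadraticLocalEquiv L v (IsCMField.complexConj L) hcδ hδ (p 0, p 1)) w') ≤ idealRadius L w'.1 𝔫 ∧
              Valued.v ((toLocalRing L v (p 2) * algebraMap L (LocalRing L v) δ -
                toLocalRing L v 2⁻¹ * (quadraticLocalEquiv L v (IsCMField.complexConj L) hcδ hδ (p 0, p 1) * conjLocal L (IsCMField.complexConj L) v (quadraticLocalEquiv L v (IsCMField.complexConj L) hcδ hδ (p 0, p 1)))) w') ≤ idealRadius L w'.1 𝔫}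
            (fun _ => (1 : ℂ)))
    (hΩ : ∀ x : Fin 3 → FiniteAdeleRing (𝓞 ↥(maximalRealSubfield L)) ↥(maximalRealSubfield L),
      φ₀ (finAdelicToAdelic (↥(maximalRealSubfield L)) L (IsCMField.complexConj L) 3 ((StdForm.antidiagonal 3).over L) (finPart (↥(maximalRealSubfield L)) L (IsCMField.complexConj L) 3 ((StdForm.antidiagonal 3).over L) ((quasiSplit (↥(maximalRealSubfield L)) L (IsCMField.complexConj L) 3).toAdelic (weylLongU ((IsCMField.complexConj L : L ≃ₐ[↥(maximalRealSubfield L)] L) : L →+* L) (rfl : (StdForm.antidiagonal 3).over L = (StdForm.antidiagonal 3).over L)) * (((heisChart hcc (((((0 : InfiniteAdeleRing L)), quadraticFiniteAdeleMap ↥(maximalRealSubfield L) L δ (x 0, x 1)) : AdeleRing (𝓞 L) L), traceZeroLine ↥(maximalRealSubfield L) L (IsCMField.complexConj L) hcδ hδ ((0, x 2) : AdeleRing (𝓞 ↥(maximalRealSubfield L)) ↥(maximalRealSubfield L)))) : ↥(adelicUnipotent ↥(maximalRealSubfield L) L (IsCMField.complexConj L) 3)) : (quasiSplit (↥(maximalRealSubfield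 L)) L (IsCMField.complexConj L) 3).Adelic)) * b₁)) *
        (((detChar (↥(maximalRealSubfield L)) L (IsCMField.complexConj L) h2 hc1 3 ((StdForm.antidiagonal 3).over L) ξ.ψ ξ.hψ (antidiagonal_over_det_ne_zero L 3)) (finAdelicToAdelic (↥(maximalRealSubfield L)) L (IsCMField.complexConj L) 3 ((StdForm.antidiagonal 3).over L) (finPart (↥(maximalRealSubfield L)) L (IsCMField.complexConj L) 3 ((StdForm.antidiagonal 3).over L) ((quasiSplit (↥(maximalRealSubfield L)) L (IsCMField.complexConj L) 3).toAdelic (weylLongU ((IsCMField.complexConj L : L ≃ₐ[↥(maximalRealSubfield L)] L) : L →+* L) (rfl : (StdForm.antidiagonal 3).over L = (StdForm.antidiagonal 3).over L)) * (((heisChart hcc (((((0 : InfiniteAdeleRing L)), quadraticFiniteAdeleMap ↥(maximalRealSubfield L) L δ (x 0, x 1)) : AdeleRing (𝓞 L) L), traceZeroLine ↥(maximalRealSubfield L) L (IsCMField.complexConj L) hcδ hδ ((0, x 2) : AdeleRing (𝓞 ↥(maximalRealSubfield L)) ↥(maximalRealSubfield L)))) : ↥(adelicUnipotent ↥(maximalRealSubfield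 L) L (IsCMField.complexConj L) 3)) : (quasiSplit (↥(maximalRealSubfield L)) L (IsCMField.complexConj L) 3).Adelic)) * b₁)) : ℂˣ) : ℂ) = ∏ᶠ v : HeightOneSpectrum (𝓞 ↥(maximalRealSubfield L)), ω v (fun i => x i v))
    (hin : ∀ z : ℂ, 2 < z.re → ∀ v ∉ S₀, ∀ w : PlacesOver L v, IsCMField.complexConj L • w.1 = w.1 →
        ((Measure.pi fun _ : Fin 3 => νv v) (integralBox ↥(maximalRealSubfield L) (Fin 3) v)).toReal⁻¹ •
            ∫ p : Fin 3 → v.adicCompletion ↥(maximalRealSubfield L),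
              ω v p * (((∏ w' : PlacesOver L v, max 1 (max ((normAbs (w'.1.adicCompletion L) (quadraticLocalEquiv L v (IsCMField.complexConj L) hcδ hδ (p 0, p 1) w') : ℝ≥0) : ℝ)
                ((normAbs (w'.1.adicCompletion L) ((toLocalRing L v (p 2) * algebraMap L (LocalRing L v) δ -
                  toLocalRing L v 2⁻¹ * (quadraticLocalEquiv L v (IsCMField.complexConj L) hcδ hδ (p 0, p 1) *
                    conjLocal L (IsCMField.complexConj L) v (quadraticLocalEquiv L v (IsCMField.complexConj L) hcδ hδ (p 0, p 1)))) w') : ℝ≥0) : ℝ))) : ℝ) : ℂ) ^ (-z)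
              ∂(Measure.pi fun _ : Fin 3 => νv v) =
          (1 - (ξ.bcη⁻¹ * μω).valueAtUniformizer w.1 * (v.residueCard : ℂ) ^ (-(2 * z))) * (1 + (ξ.bcη⁻¹ * μω).valueAtUniformizer w.1 * (v.residueCard : ℂ) ^ (-(2 * z - 1))) /
            ((1 - (ξ.bcη⁻¹ * μω).valueAtUniformizer w.1 * (v.residueCard : ℂ) ^ (-(2 * z - 2))) * (1 + (ξ.bcη⁻¹ * μω).valueAtUniformizer w.1 * (v.residueCard : ℂ) ^ (-(2 * z - 2)))))
    (hsp : ∀ z : ℂ, 2 < z.re → ∀ v ∉ S₀, ∀ w : PlacesOver L v, IsCMField.complexConj L • w.1 ≠ w.1 →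
        ((Measure.pi fun _ : Fin 3 => νv v) (integralBox ↥(maximalRealSubfield L) (Fin 3) v)).toReal⁻¹ •
            ∫ p : Fin 3 → v.adicCompletion ↥(maximalRealSubfield L),
              ω v p * (((∏ w' : PlacesOver L v, max 1 (max ((normAbs (w'.1.adicCompletion L) (quadraticLocalEquiv L v (IsCMField.complexConj L) hcδ hδ (p 0, p 1) w') : ℝ≥0) : ℝ)
                ((normAbs (w'.1.adicCompletion L) ((toLocalRing L v (p 2) * algebraMap L (LocalRing L v) δ -
                  toLocalRing L v 2⁻¹ * (quadraticLocalEquiv L v (IsCMField.complexConj L) hcδ hδ (p 0, p 1) *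
                    conjLocal L (IsCMField.complexConj L) v (quadraticLocalEquiv L v (IsCMField.complexConj L) hcδ hδ (p 0, p 1)))) w') : ℝ≥0) : ℝ))) : ℝ) : ℂ) ^ (-z)
              ∂(Measure.pi fun _ : Fin 3 => νv v) =
          (1 - (ξ.bcη⁻¹ * μω).valueAtUniformizer w.1 * (v.residueCard : ℂ) ^ (-z)) * (1 - (ξ.bcη⁻¹ * μω).valueAtUniformizer (PlacesOver.galInv (IsCMField.complexConj L) w).1 * (v.residueCard : ℂ) ^ (-z)) *
              (1 - (ξ.bcη⁻¹ * μω).valueAtUniformizer w.1 * (ξ.bcη⁻¹ * μω).valueAtUniformizer (PlacesOver.galInv (IsCMField.complexConj L) w).1 * (v.residueCard : ℂ) ^ (-(2 * z - 1))) /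
            ((1 - (ξ.bcη⁻¹ * μω).valueAtUniformizer w.1 * (v.residueCard : ℂ) ^ (-(z - 1))) * (1 - (ξ.bcη⁻¹ * μω).valueAtUniformizer (PlacesOver.galInv (IsCMField.complexConj L) w).1 * (v.residueCard : ℂ) ^ (-(z - 1))) *
              (1 - (ξ.bcη⁻¹ * μω).valueAtUniformizer w.1 * (ξ.bcη⁻¹ * μω).valueAtUniformizer (PlacesOver.galInv (IsCMField.complexConj L) w).1 * (v.residueCard : ℂ) ^ (-(2 * z - 2))))) :
    ∀ z : ℂ, 2 < z.re → (∫ v : ↥(adelicUnipotent (↥(maximalRealSubfield L)) L (IsCMField.complexConj L) 3), flatSectionU φ₀ z ((quasiSplit (↥(maximalRealSubfield L)) L (IsCMField.complexConj L) 3).toAdelic (weylLongU ((IsCMField.complexConj L : L ≃ₐ[↥(maximalRealSubfield L)] L) : L →+* L) (rfl : (StdForm.antidiagonal 3).over L = (StdForm.antidiagonal 3).over L)) * ((v : (quasiSplit (↥(maximalRealSubfield L)) L (IsCMField.complexConj L) 3).Adelic) * (finAdelicToAdelic (↥(maximalRealSubfield L)) L (IsCMField.complexConj L) 3 ((StdForm.antidiagonal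 3).over L) b₁))) ∂ν) * (((borelHeight (finAdelicToAdelic (↥(maximalRealSubfield L)) L (IsCMField.complexConj L) 3 ((StdForm.antidiagonal 3).over L) b₁) : ℝ) : ℂ) ^ (z - 2)) *
        (((detChar (↥(maximalRealSubfield L)) L (IsCMField.complexConj L) h2 hc1 3 ((StdForm.antidiagonal 3).over L) ξ.ψ ξ.hψ (antidiagonal_over_det_ne_zero L 3)) (finAdelicToAdelic (↥(maximalRealSubfield L)) L (IsCMField.complexConj L) 3 ((StdForm.antidiagonal 3).over L) b₁) : ℂˣ) : ℂ) = (fun z : ℂ => (((unfoldingHaarConst L hcc hcδ hδ hd ν h𝓕N μE μE₁ μE₂ μF μF₁ μF₂ νv hφu (isUnitary_quadraticHeckeCharCM_mul_self L) (bcηInv_mul_ideleBaseChange_eq L ξ hμω) : ℝ) : ℂ) * ∏ v ∈ S₀, ((Measure.pi fun _ : Fin 3 => νv v) (integralBox ↥(maximalRealSubfield L) (Fin 3) v)).toReal⁻¹ •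
              ∫ p : Fin 3 → v.adicCompletion ↥(maximalRealSubfield L),
                Set.indicator {p : Fin 3 → v.adicCompletion ↥(maximalRealSubfield L) | p ∈ integralBox ↥(maximalRealSubfield L) (Fin 3) v ∧ ∀ w' : PlacesOver L v,
                    Valued.v (quadraticLocalEquiv L v (IsCMField.complexConj L) hcδ hδ (p 0, p 1) w') ≤ idealRadius L w'.1 𝔫 ∧
                    Valued.v (conjLocal L (IsCMField.complexConj L) v (quadraticLocalEquiv L v (IsCMField.complexConj L) hcδ hδ (p 0, p 1)) w') ≤ idealRadius L w'.1 𝔫 ∧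
                    Valued.v ((toLocalRing L v (p 2) * algebraMap L (LocalRing L v) δ -
                      toLocalRing L v 2⁻¹ * (quadraticLocalEquiv L v (IsCMField.complexConj L) hcδ hδ (p 0, p 1) * conjLocal L (IsCMField.complexConj L) v (quadraticLocalEquiv L v (IsCMField.complexConj L) hcδ hδ (p 0, p 1)))) w') ≤ idealRadius L w'.1 𝔫}
                  (fun _ => (1 : ℂ)) p *
                (((∏ w' : PlacesOver L v, max 1 (max ((normAbs (w'.1.adicCompletion L) (quadraticLocalEquiv L v (IsCMField.complexConj L) hcδ hδ (p 0, p 1) w') : ℝ≥0) : ℝ)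
                  ((normAbs (w'.1.adicCompletion L) ((toLocalRing L v (p 2) * algebraMap L (LocalRing L v) δ -
                    toLocalRing L v 2⁻¹ * (quadraticLocalEquiv L v (IsCMField.complexConj L) hcδ hδ (p 0, p 1) *
                      conjLocal L (IsCMField.complexConj L) v (quadraticLocalEquiv L v (IsCMField.complexConj L) hcδ hδ (p 0, p 1)))) w') : ℝ≥0) : ℝ))) : ℝ) : ℂ) ^ (-z) ∂(Measure.pi fun _ : Fin 3 => νv v)) *
            ∫ Xi : InfiniteAdeleRing L, ∫ a : InfiniteAdeleRing ↥(maximalRealSubfield L),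
            (∏ w : InfinitePlace L, unfoldingArchPhase L ξ w * archUnitaryValue (kμ w - 2 * ξ.eη w) 0 ((((-(1 + ‖Xi w‖ ^ 2 / 2)) : ℝ) : ℂ) + (((w.embedding δ).im * ((InfiniteAdeleRing.ringEquiv_mixedSpace ↥(maximalRealSubfield L)) a).1 ⟨w.comap (algebraMap ↥(maximalRealSubfield L) L), Summit.HodgeConjecture.HodgeConjecture.Cruxes.H413.K2E1HeightBigCellLineFormulaU2.isReal_comap_maximalRealSubfield L w⟩ : ℝ) : ℂ) * Complex.I) * (((2 : ℂ) + ((((-(1 + ‖Xi w‖ ^ 2 / 2)) : ℝ) : ℂ) + (((w.embedding δ).im * ((InfiniteAdeleRing.ringEquiv_mixedSpace ↥(maximalRealSubfield L)) a).1 ⟨w.comap (algebraMap ↥(maximalRealSubfield L) L), Summit.HodgeConjecture.HodgeConjecture.Cruxes.H413.K2E1HeightBigCellLineFormulaU2.isReal_comap_maximalRealSubfield L w⟩ : ℝ) : ℂ) * Complex.I)) / ((((-(1 + ‖Xi w‖ ^ 2 / 2)) : ℝ) : ℂ) + (((w.embedding δ).im * ((InfiniteAdeleRing.ringEquiv_mixedSpace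 ↥(maximalRealSubfield L)) a).1 ⟨w.comap (algebraMap ↥(maximalRealSubfield L) L), Summit.HodgeConjecture.HodgeConjecture.Cruxes.H413.K2E1HeightBigCellLineFormulaU2.isReal_comap_maximalRealSubfield L w⟩ : ℝ) : ℂ) * Complex.I)) ^ (((kμ w - 2 * ξ.eη w) - 1) / 2).toNat * (((2 : ℂ) + conj ((((-(1 + ‖Xi w‖ ^ 2 / 2)) : ℝ) : ℂ) + (((w.embedding δ).im * ((InfiniteAdeleRing.ringEquiv_mixedSpace ↥(maximalRealSubfield L)) a).1 ⟨w.comap (algebraMap ↥(maximalRealSubfield L) L), Summit.HodgeConjecture.HodgeConjecture.Cruxes.H413.K2E1HeightBigCellLineFormulaU2.isReal_comap_maximalRealSubfield L w⟩ : ℝ) : ℂ) * Complex.I)) / conj ((((-(1 + ‖Xi w‖ ^ 2 / 2)) : ℝ) : ℂ) + (((w.embedding δ).im * ((InfiniteAdeleRing.ringEquiv_mixedSpace ↥(maximalRealSubfield L)) a).1 ⟨w.comap (algebraMap ↥(maximalRealSubfield L) L), Summit.HodgeConjecture.HodgeConjecture.Cruxes.H413.K2E1HeightBigCellLineFormulaU2.isReal_comap_maximalRealSubfield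 L w⟩ : ℝ) : ℂ) * Complex.I)) ^ ((-(kμ w - 2 * ξ.eη w) - 1) / 2).toNat) *
              ((((∏ w : InfinitePlace L, ((1 + ‖(Xi) w‖ ^ 2 / 2) ^ 2 + (w δ) ^ 2 * (((InfiniteAdeleRing.ringEquiv_mixedSpace ↥(maximalRealSubfield L)) a).1 ⟨w.comap (algebraMap ↥(maximalRealSubfield L) L), Summit.HodgeConjecture.HodgeConjecture.Cruxes.H413.K2E1HeightBigCellLineFormulaU2.isReal_comap_maximalRealSubfield L w⟩) ^ 2))) : ℝ) : ℂ) ^ (-z) ∂μF₁ ∂μE₁) z *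
          ((partialStandardL {w : HeightOneSpectrum (𝓞 L) | w.under (𝓞 ↥(maximalRealSubfield L)) ∈ (↑S₀ : Set (HeightOneSpectrum (𝓞 ↥(maximalRealSubfield L))))} (fun w => {(ξ.bcη⁻¹ * μω).valueAtUniformizer w}) (z - 1) * partialStandardL (↑S₀ : Set (HeightOneSpectrum (𝓞 ↥(maximalRealSubfield L)))) (fun v => {(1 : HeckeCharacter ↥(maximalRealSubfield L)).valueAtUniformizer v}) (2 * z - 2)) /
            (partialStandardL {w : HeightOneSpectrum (𝓞 L) | w.under (𝓞 ↥(maximalRealSubfield L)) ∈ (↑S₀ : Set (HeightOneSpectrum (𝓞 ↥(maximalRealSubfield L))))} (fun w => {(ξ.bcη⁻¹ * μω).valueAtUniformizer w}) z * partialStandardL (↑S₀ : Set (HeightOneSpectrum (𝓞 ↥(maximalRealSubfield L)))) (fun v => {(1 : HeckeCharacter ↥(maximalRealSubfield L)).valueAtUniformizer v}) (2 * z - 1))) := by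
  -- (0) the scalar sub-row: the exponents of record vanish
  have hP : (fun w : InfinitePlace L => (((kμ w - 2 * ξ.eη w) - 1) / 2).toNat) = (0 : InfinitePlace L → ℕ) := by
    funext w
    rcases hm1 w with h | h <;> simp [h]
  have hQ : (fun w : InfinitePlace L => ((-(kμ w - 2 * ξ.eη w) - 1) / 2).toNat) = (0 : InfinitePlace L → ℕ) := by
    funext w
    rcases hm1 w with h | h <;> simp [h]
  -- (1) the witness facts: pair law of `φ₀`, structure theorem, the identification `Φ^{0,0}·Φf^{pair} = φ₀·Θ` (★ p865238)
  have hφ₀pair : IsChiSectionPair (ξ.bcη⁻¹ * μω) (1 : ↥(TorusDict.torus (IsCMField.complexConj L)) →ₜ* ℂˣ) φ₀ :=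
    IsChiSection.isChiSectionPair_of_trivial (fun t => by rw [ContinuousMonoidHom.coe_one, Pi.one_apply]) (isChiSection_of_mem hφ₀V)
  have hφ₀V' : φ₀ ∈ chiSectionSpacePair (ξ.bcη⁻¹ * μω) (1 : ↥(TorusDict.torus (IsCMField.complexConj L)) →ₜ* ℂˣ) (levelOfRecord L Kf) (omegaOfRecord L (ξ.bcη⁻¹ * μω) (1 : ↥(TorusDict.torus (IsCMField.complexConj L)) →ₜ* ℂˣ) Kf) := by
    rw [chiSectionSpacePair_one]
    exact hφ₀V
  have hstruct : ∀ g : (quasiSplit (↥(maximalRealSubfield L)) L (IsCMField.complexConj L) 3).Adelic, φ₀ g = archSectionE L (ξ.bcη⁻¹ * μω) (1 : ↥(TorusDict.torus (IsCMField.complexConj L)) →ₜ* ℂˣ) (archPart (↥(maximalRealSubfield L)) L (IsCMField.complexConj L) 3 ((StdForm.antidiagonal 3).over L) g) * φ₀ (finAdelicToAdelic (↥(maximalRealSubfield L)) L (IsCMField.complexConj L) 3 ((StdForm.antidiagonal 3).over L) (finPart (↥(maximalRealSubfield L)) L (IsCMField.complexConj L) 3 ((StdForm.antidiagonal 3).over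 L) g)) :=
    fun g => apply_eq_archSectionE_mul_apply_finAdelicToAdelic L (ξ.bcη⁻¹ * μω) (1 : ↥(TorusDict.torus (IsCMField.complexConj L)) →ₜ* ℂˣ) Kf hφ₀V' g
  have hwit : (fun g : (quasiSplit (↥(maximalRealSubfield L)) L (IsCMField.complexConj L) 3).Adelic => archSectionShifted L (ξ.bcη⁻¹ * ξ.bcψ⁻¹ * μω) ξ.ψ (fun w : InfinitePlace L => (((kμ w - 2 * ξ.eη w) - 1) / 2).toNat)
      (fun w : InfinitePlace L => ((-(kμ w - 2 * ξ.eη w) - 1) / 2).toNat) (archPart (↥(maximalRealSubfield L)) L (IsCMField.complexConj L) 3 ((StdForm.antidiagonal 3).over L) g) *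
        (fun u : ↥(finAdelic (↥(maximalRealSubfield L)) L (IsCMField.complexConj L) 3 ((StdForm.antidiagonal 3).over L)) => φ₀ (finAdelicToAdelic (↥(maximalRealSubfield L)) L (IsCMField.complexConj L) 3 ((StdForm.antidiagonal 3).over L) u) * (((detChar (↥(maximalRealSubfield L)) L (IsCMField.complexConj L) h2 hc1 3 ((StdForm.antidiagonal 3).over L) ξ.ψ ξ.hψ (antidiagonal_over_det_ne_zero L 3)) (finAdelicToAdelic (↥(maximalRealSubfield L)) L (IsCMField.complexConj L) 3 ((StdForm.antidiagonal 3).over L) u) : ℂˣ) : ℂ)) (finPart (↥(maximalRealSubfield L)) L (IsCMField.complexConj L) 3 ((StdForm.antidiagonal 3).over L) g)) =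
      fun g => φ₀ g * (((detChar (↥(maximalRealSubfield L)) L (IsCMField.complexConj L) h2 hc1 3 ((StdForm.antidiagonal 3).over L) ξ.ψ ξ.hψ (antidiagonal_over_det_ne_zero L 3)) g : ℂˣ) : ℂ) := by
    funext g
    rw [hP, hQ]
    beta_reduce
    have hM3 := untwisted_mul_detChar_eq_pairWitness L (ξ.bcη⁻¹ * μω) ξ h2 hc1 (fun u : ↥(finAdelic (↥(maximalRealSubfield L)) L (IsCMField.complexConj L) 3 ((StdForm.antidiagonal 3).over L)) => φ₀ (finAdelicToAdelic (↥(maximalRealSubfield L)) L (IsCMField.complexConj L) 3 ((StdForm.antidiagonal 3).over L) u)) g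
    beta_reduce at hM3
    rw [show ξ.bcη⁻¹ * ξ.bcψ⁻¹ * μω = ξ.bcη⁻¹ * μω * ξ.bcψ⁻¹ from mul_right_comm _ _ _, ← hM3, hstruct g]
  -- `hΦ`: the pair law of the pair witness (★ `isChiSectionPair_mul_detChar` on `φ₀·Θ`; `pullback ξ.ψ = ξ.bcψ` by `rfl`, `1·ξ.ψ = ξ.ψ`)
  have hχ : (ξ.bcη⁻¹ * μω) * (TorusDict.pullback (IsCMField.complexConj L) h2 hc1 ξ.ψ ξ.hψ)⁻¹ = ξ.bcη⁻¹ * ξ.bcψ⁻¹ * μω := by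
    have hp : TorusDict.pullback (IsCMField.complexConj L) h2 hc1 ξ.ψ ξ.hψ = ξ.bcψ := rfl
    rw [hp, mul_right_comm]
  have h1 : (1 : ↥(TorusDict.torus (IsCMField.complexConj L)) →ₜ* ℂˣ) * ξ.ψ = ξ.ψ := one_mul ξ.ψ
  have hΦ : IsChiSectionPair (ξ.bcη⁻¹ * ξ.bcψ⁻¹ * μω) ξ.ψ (fun g : (quasiSplit (↥(maximalRealSubfield L)) L (IsCMField.complexConj L) 3).Adelic => archSectionShifted L (ξ.bcη⁻¹ * ξ.bcψ⁻¹ * μω) ξ.ψ (fun w : InfinitePlace L => (((kμ w - 2 * ξ.eη w) - 1) / 2).toNat)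
      (fun w : InfinitePlace L => ((-(kμ w - 2 * ξ.eη w) - 1) / 2).toNat) (archPart (↥(maximalRealSubfield L)) L (IsCMField.complexConj L) 3 ((StdForm.antidiagonal 3).over L) g) *
        (fun u : ↥(finAdelic (↥(maximalRealSubfield L)) L (IsCMField.complexConj L) 3 ((StdForm.antidiagonal 3).over L)) => φ₀ (finAdelicToAdelic (↥(maximalRealSubfield L)) L (IsCMField.complexConj L) 3 ((StdForm.antidiagonal 3).over L) u) * (((detChar (↥(maximalRealSubfield L)) L (IsCMField.complexConj L) h2 hc1 3 ((StdForm.antidiagonal 3).over L) ξ.ψ ξ.hψ (antidiagonal_over_det_ne_zero L 3)) (finAdelicToAdelic (↥(maximalRealSubfield L)) L (IsCMField.complexConj L) 3 ((StdForm.antidiagonal 3).over L) u) : ℂˣ) : ℂ)) (finPart (↥(maximalRealSubfield L)) L (IsCMField.complexConj L) 3 ((StdForm.antidiagonal 3).over L) g)) := by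
    rw [hwit]
    have h := isChiSectionPair_mul_detChar h2 hc1 (antidiagonal_over_det_ne_zero L 3) ξ.ψ ξ.hψ hφ₀pair
    rwa [hχ, h1] at h
  -- `hEis`: the twisted continuation is the Eisenstein family of the pair witness on the tube
  have hEis : ∀ z : ℂ, 2 < z.re → (fun (z : ℂ) (x : (quasiSplit (↥(maximalRealSubfield L)) L (IsCMField.complexConj L) 3).Adelic) => Ec₀ z x * (((detChar (↥(maximalRealSubfield L)) L (IsCMField.complexConj L) h2 hc1 3 ((StdForm.antidiagonal 3).over L) ξ.ψ ξ.hψ (antidiagonal_over_det_ne_zero L 3)) x : ℂˣ) : ℂ)) z =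
      eisensteinSeriesU (flatSectionU (fun g : (quasiSplit (↥(maximalRealSubfield L)) L (IsCMField.complexConj L) 3).Adelic => archSectionShifted L (ξ.bcη⁻¹ * ξ.bcψ⁻¹ * μω) ξ.ψ (fun w : InfinitePlace L => (((kμ w - 2 * ξ.eη w) - 1) / 2).toNat)
      (fun w : InfinitePlace L => ((-(kμ w - 2 * ξ.eη w) - 1) / 2).toNat) (archPart (↥(maximalRealSubfield L)) L (IsCMField.complexConj L) 3 ((StdForm.antidiagonal 3).over L) g) *
        (fun u : ↥(finAdelic (↥(maximalRealSubfield L)) L (IsCMField.complexConj L) 3 ((StdForm.antidiagonal 3).over L)) => φ₀ (finAdelicToAdelic (↥(maximalRealSubfield L)) L (IsCMField.complexConj L) 3 ((StdForm.antidiagonal 3).over L) u) * (((detChar (↥(maximalRealSubfield L)) L (IsCMField.complexConj L) h2 hc1 3 ((StdForm.antidiagonal 3).over L) ξ.ψ ξ.hψ (antidiagonal_over_det_ne_zero L 3)) (finAdelicToAdelic (↥(maximalRealSubfield L)) L (IsCMField.complexConj L) 3 ((StdForm.antidiagonal 3).over L) u) : ℂˣ) : ℂ)) (finPart (↥(maximalRealSubfield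 L)) L (IsCMField.complexConj L) 3 ((StdForm.antidiagonal 3).over L) g)) z) := by
    intro z hz
    rw [hwit]
    funext x
    beta_reduce
    rw [eisensteinSeriesU_flatSectionU_mul_automorphicCharacter, hEis₀ z hz]
  -- `hΦfc hΦfM`: the pair finite reading is continuous and bounded (`|Θ| = 1`)
  have hΘc : Continuous fun x : (quasiSplit (↥(maximalRealSubfield L)) L (IsCMField.complexConj L) 3).Adelic => (((detChar (↥(maximalRealSubfield L)) L (IsCMField.complexConj L) h2 hc1 3 ((StdForm.antidiagonal 3).over L) ξ.ψ ξ.hψ (antidiagonal_over_det_ne_zero L 3)) x : ℂˣ) : ℂ) :=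
    (detChar (↥(maximalRealSubfield L)) L (IsCMField.complexConj L) h2 hc1 3 ((StdForm.antidiagonal 3).over L) ξ.ψ ξ.hψ (antidiagonal_over_det_ne_zero L 3)).continuous_coe
  have hΦfc : Continuous (fun u : ↥(finAdelic (↥(maximalRealSubfield L)) L (IsCMField.complexConj L) 3 ((StdForm.antidiagonal 3).over L)) => φ₀ (finAdelicToAdelic (↥(maximalRealSubfield L)) L (IsCMField.complexConj L) 3 ((StdForm.antidiagonal 3).over L) u) * (((detChar (↥(maximalRealSubfield L)) L (IsCMField.complexConj L) h2 hc1 3 ((StdForm.antidiagonal 3).over L) ξ.ψ ξ.hψ (antidiagonal_over_det_ne_zero L 3)) (finAdelicToAdelic (↥(maximalRealSubfield L)) L (IsCMField.complexConj L) 3 ((StdForm.antidiagonal 3).over L) u) : ℂˣ) : ℂ)) :=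
    (hφ₀c.comp (continuous_finAdelicToAdelic _ _ _ _ _)).mul (hΘc.comp (continuous_finAdelicToAdelic _ _ _ _ _))
  have hΦfM : ∀ u : ↥(finAdelic (↥(maximalRealSubfield L)) L (IsCMField.complexConj L) 3 ((StdForm.antidiagonal 3).over L)), ‖(fun u : ↥(finAdelic (↥(maximalRealSubfield L)) L (IsCMField.complexConj L) 3 ((StdForm.antidiagonal 3).over L)) => φ₀ (finAdelicToAdelic (↥(maximalRealSubfield L)) L (IsCMField.complexConj L) 3 ((StdForm.antidiagonal 3).over L) u) * (((detChar (↥(maximalRealSubfield L)) L (IsCMField.complexConj L) h2 hc1 3 ((StdForm.antidiagonal 3).over L) ξ.ψ ξ.hψ (antidiagonal_over_det_ne_zero L 3)) (finAdelicToAdelic (↥(maximalRealSubfield L)) L (IsCMField.complexConj L) 3 ((StdForm.antidiagonal 3).over L) u) : ℂˣ) : ℂ)) u‖ ≤ Mφ := fun u => by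
    beta_reduce
    rw [norm_mul, AutomorphicCharacter.norm_coe, mul_one]
    exact hφ₀M _
  -- (2)+(3): per `z`, ★ p864821 at the pair witness, the glue §1, then ★ p865258 packages ED. 16's bytes
  refine hsrc16_of_ctQuotient_at_basePoint L ν h𝓕N h𝓕c h𝓕1 hφ₀pair hφ₀c hφ₀M Ec₀ hEis₀ _ _ _ (finAdelicToAdelic (↥(maximalRealSubfield L)) L (IsCMField.complexConj L) 3 ((StdForm.antidiagonal 3).over L) b₁) (fun z hz => ?_)
  have h21 := hsrc_of_record_at_basePoint_of_core L hcc hcδ hδ hd ν h𝓕N μE μE₁ μE₂ μF μF₁ μF₂ νv h𝓕c h𝓕1 ξ hμ hφu (isUnitary_quadraticHeckeCharCM_mul_self L) (bcηInv_mul_ideleBaseChange_eq L ξ hμω)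
    (fun w : InfinitePlace L => (((kμ w - 2 * ξ.eη w) - 1) / 2).toNat) (fun w : InfinitePlace L => ((-(kμ w - 2 * ξ.eη w) - 1) / 2).toNat)
    (fun u : ↥(finAdelic (↥(maximalRealSubfield L)) L (IsCMField.complexConj L) 3 ((StdForm.antidiagonal 3).over L)) => φ₀ (finAdelicToAdelic (↥(maximalRealSubfield L)) L (IsCMField.complexConj L) 3 ((StdForm.antidiagonal 3).over L) u) * (((detChar (↥(maximalRealSubfield L)) L (IsCMField.complexConj L) h2 hc1 3 ((StdForm.antidiagonal 3).over L) ξ.ψ ξ.hψ (antidiagonal_over_det_ne_zero L 3)) (finAdelicToAdelic (↥(maximalRealSubfield L)) L (IsCMField.complexConj L) 3 ((StdForm.antidiagonal 3).over L) u) : ℂˣ) : ℂ)) hΦfc hΦfM hΦ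
    (fun (z : ℂ) (x : (quasiSplit (↥(maximalRealSubfield L)) L (IsCMField.complexConj L) 3).Adelic) => Ec₀ z x * (((detChar (↥(maximalRealSubfield L)) L (IsCMField.complexConj L) h2 hc1 3 ((StdForm.antidiagonal 3).over L) ξ.ψ ξ.hψ (antidiagonal_over_det_ne_zero L 3)) x : ℂˣ) : ℂ)) hEis hb₁ S₀ hgood 𝔫 ω hωc hω1 hωS₀ hΩ hin hsp z hz
  have hwit1 := congrFun hwit (finAdelicToAdelic (↥(maximalRealSubfield L)) L (IsCMField.complexConj L) 3 ((StdForm.antidiagonal 3).over L) b₁)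
  beta_reduce at hwit1
  beta_reduce at h21
  rw [hwit1] at h21
  rw [hct_of_pairUnfolding L ν 𝓕 (detChar (↥(maximalRealSubfield L)) L (IsCMField.complexConj L) h2 hc1 3 ((StdForm.antidiagonal 3).over L) ξ.ψ ξ.hψ (antidiagonal_over_det_ne_zero L 3)) (Ec₀ z) φ₀ (finAdelicToAdelic (↥(maximalRealSubfield L)) L (IsCMField.complexConj L) 3 ((StdForm.antidiagonal 3).over L) b₁) z _ h21]

/-! ## §3 HEAD: the assembler at `S₀ := unfoldingBadPlaces hδ h𝔫`, `hgood` discharged -/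

/-- **HEAD `hsrc16_of_coreLetters` — THE (V-1) SCALAR-SUB-ROW `hsrc` OF RECORD** at the bad finset of record `S₀ := unfoldingBadPlaces hδ h𝔫` (★ p864662; `hgood` := ★
`hgood_unfoldingBadPlaces` from `hφ𝔫 :` «the conductor of `φ_ξ = ξ.bcη⁻¹·μω` divides the level `𝔫`»): ED. 16's `hsrc` bytes at `g₁ := ι_f b₁`, `C := unfoldingHaarConst …`,
`ε := unfoldingArchPhase ξ`, `(S, T′) := (places over S₀, S₀)`, modulo ★ p864821's six local letters. [cite: MoeglinWaldspurger1995, II.1.6–II.1.7, IV.1.11] [cite: Rogawski1990, §13.9 p. 229]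
[cite: TateThesis1967, Thm 3.3.1] -/
theorem hsrc16_of_coreLetters
    (hcc : IsCMField.complexConj L * IsCMField.complexConj L = 1) (h2 : Module.finrank (↥(maximalRealSubfield L)) L = 2) (hc1 : IsCMField.complexConj L ≠ 1)
    {δ : L} (hcδ : IsCMField.complexConj L δ = -δ) (hδ : δ ≠ 0) {d : ↥(maximalRealSubfield L)} (hd : δ * δ = algebraMap ↥(maximalRealSubfield L) L d)
    [MeasurableSpace (quasiSplit (↥(maximalRealSubfield L)) L (IsCMField.complexConj L) 3).Adelic] [BorelSpace (quasiSplit (↥(maximalRealSubfield L)) L (IsCMField.complexConj L) 3).Adelic]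
    [MeasurableSpace (AdeleRing (𝓞 L) L)] [BorelSpace (AdeleRing (𝓞 L) L)]
    [MeasurableSpace (AdeleRing (𝓞 ↥(maximalRealSubfield L)) ↥(maximalRealSubfield L))] [BorelSpace (AdeleRing (𝓞 ↥(maximalRealSubfield L)) ↥(maximalRealSubfield L))]
    [MeasurableSpace (InfiniteAdeleRing L)] [BorelSpace (InfiniteAdeleRing L)]
    [MeasurableSpace (InfiniteAdeleRing ↥(maximalRealSubfield L))] [BorelSpace (InfiniteAdeleRing ↥(maximalRealSubfield L))]
    [MeasurableSpace (FiniteAdeleRing (𝓞 L) L)] [BorelSpace (FiniteAdeleRing (𝓞 L) L)]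
    [MeasurableSpace (FiniteAdeleRing (𝓞 ↥(maximalRealSubfield L)) ↥(maximalRealSubfield L))] [BorelSpace (FiniteAdeleRing (𝓞 ↥(maximalRealSubfield L)) ↥(maximalRealSubfield L))]
    [∀ v : HeightOneSpectrum (𝓞 ↥(maximalRealSubfield L)), MeasurableSpace (v.adicCompletion ↥(maximalRealSubfield L))] [∀ v : HeightOneSpectrum (𝓞 ↥(maximalRealSubfield L)), BorelSpace (v.adicCompletion ↥(maximalRealSubfield L))]
    (ν : Measure ↥(adelicUnipotent ↥(maximalRealSubfield L) L (IsCMField.complexConj L) 3)) [ν.IsHaarMeasure]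
    {𝓕 : Set ↥(adelicUnipotent ↥(maximalRealSubfield L) L (IsCMField.complexConj L) 3)} (h𝓕N : IsFundamentalDomain ↥(rationalUnipotent ↥(maximalRealSubfield L) L (IsCMField.complexConj L) 3) 𝓕 ν)
    (h𝓕c : IsCompact (closure 𝓕)) (h𝓕1 : ν 𝓕 = 1)
    (μE : Measure (AdeleRing (𝓞 L) L)) [μE.IsAddHaarMeasure] (μE₁ : Measure (InfiniteAdeleRing L)) [μE₁.IsAddHaarMeasure]
    (μE₂ : Measure (FiniteAdeleRing (𝓞 L) L)) [μE₂.IsAddHaarMeasure]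
    (μF : Measure (AdeleRing (𝓞 ↥(maximalRealSubfield L)) ↥(maximalRealSubfield L))) [μF.IsAddHaarMeasure] (μF₁ : Measure (InfiniteAdeleRing ↥(maximalRealSubfield L))) [μF₁.IsAddHaarMeasure]
    (μF₂ : Measure (FiniteAdeleRing (𝓞 ↥(maximalRealSubfield L)) ↥(maximalRealSubfield L))) [μF₂.IsAddHaarMeasure]
    (νv : ∀ v : HeightOneSpectrum (𝓞 ↥(maximalRealSubfield L)), Measure (v.adicCompletion ↥(maximalRealSubfield L))) [∀ v, (νv v).IsAddHaarMeasure]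
    -- the block of record: `μω` unitary of arch type `(kμ, 0)` restricting to `ε_{L∕L⁺}` (socket (V)'s `hμω`; `hφu` := ★ `isUnitary_bcηInv_mul L ξ hμu`); the SCALAR SUB-ROW `|m_w| = 1` (J-S8-M3′ `hm1`)
    (ξ : OneDimAutRepH L) {μω : HeckeCharacter L} (hφu : (ξ.bcη⁻¹ * μω).IsUnitary)
    (hμω : ∀ x : ideleGroup ↥(maximalRealSubfield L), μω (AdeleRing.ideleBaseChange (↥(maximalRealSubfield L)) L x) = quadraticHeckeCharCM L x)
    {kμ : InfinitePlace L → ℤ} (hμ : μω.HasUnitaryArchType kμ 0) (hm1 : ∀ w, kμ w - 2 * ξ.eη w = 1 ∨ kμ w - 2 * ξ.eη w = -1)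
    -- the UNTWISTED witness of record in its level-of-record block (the keeper's `φ₀ hφ₀V hφ₀c hφ₀M`), its tube continuation `Ec₀` (`hEis₀`), the base point `ι_f b₁ ∈ K`, the level `𝔫`
    {Kf : Subgroup ↥(finAdelic (↥(maximalRealSubfield L)) L (IsCMField.complexConj L) 3 ((StdForm.antidiagonal 3).over L))}
    {φ₀ : (quasiSplit (↥(maximalRealSubfield L)) L (IsCMField.complexConj L) 3).Adelic → ℂ}
    (hφ₀V : φ₀ ∈ chiSectionSpace (ξ.bcη⁻¹ * μω) (levelOfRecord L Kf) (omegaOfRecord L (ξ.bcη⁻¹ * μω) (1 : ↥(TorusDict.torus (IsCMField.complexConj L)) →ₜ* ℂˣ) Kf))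
    (hφ₀c : Continuous φ₀) {Mφ : ℝ} (hφ₀M : ∀ x, ‖φ₀ x‖ ≤ Mφ)
    (Ec₀ : ℂ → (quasiSplit (↥(maximalRealSubfield L)) L (IsCMField.complexConj L) 3).Adelic → ℂ) (hEis₀ : ∀ z : ℂ, 2 < z.re → Ec₀ z = eisensteinSeriesU (flatSectionU φ₀ z))
    {b₁ : ↥(finAdelic (↥(maximalRealSubfield L)) L (IsCMField.complexConj L) 3 ((StdForm.antidiagonal 3).over L))} (hb₁ : finAdelicToAdelic (↥(maximalRealSubfield L)) L (IsCMField.complexConj L) 3 ((StdForm.antidiagonal 3).over L) b₁ ∈ ((standardMaximalCompactGL 3 L).comap (adelicVal (↥(maximalRealSubfield L)) L (IsCMField.complexConj L) 3 ((StdForm.antidiagonal 3).over L)) : Subgroup (quasiSplit (↥(maximalRealSubfield L)) L (IsCMField.complexConj L) 3).Adelic))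
    (𝔫 : Ideal (𝓞 L))
    -- the level `𝔫 ≠ 0` carries the conductor of `φ_ξ` (`hgood` := ★ `hgood_unfoldingBadPlaces` at `S₀ := unfoldingBadPlaces hδ h𝔫`); ★ p864821's LOCAL LETTERS there
    (h𝔫 : 𝔫 ≠ 0) (hφ𝔫 : ∀ w : HeightOneSpectrum (𝓞 L), ¬ (ξ.bcη⁻¹ * μω).IsUnramifiedAt w → w.asIdeal ∣ 𝔫)
    (ω : ∀ v : HeightOneSpectrum (𝓞 ↥(maximalRealSubfield L)), (Fin 3 → v.adicCompletion ↥(maximalRealSubfield L)) → ℂ)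
    (hωc : ∀ z : ℂ, 2 < z.re → ∀ v, Continuous fun p : Fin 3 → v.adicCompletion ↥(maximalRealSubfield L) =>
        ω v p * (((∏ w' : PlacesOver L v, max 1 (max ((normAbs (w'.1.adicCompletion L) (quadraticLocalEquiv L v (IsCMField.complexConj L) hcδ hδ (p 0, p 1) w') : ℝ≥0) : ℝ)
            ((normAbs (w'.1.adicCompletion L) ((toLocalRing L v (p 2) * algebraMap L (LocalRing L v) δ -
              toLocalRing L v 2⁻¹ * (quadraticLocalEquiv L v (IsCMField.complexConj L) hcδ hδ (p 0, p 1) *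
                conjLocal L (IsCMField.complexConj L) v (quadraticLocalEquiv L v (IsCMField.complexConj L) hcδ hδ (p 0, p 1)))) w') : ℝ≥0) : ℝ))) : ℝ) : ℂ) ^ (-z))
    (hω1 : ∀ v ∉ (unfoldingBadPlaces L hδ h𝔫), ∀ p ∈ integralBox ↥(maximalRealSubfield L) (Fin 3) v, ω v p = 1)
    (hωS₀ : ∀ v ∈ (unfoldingBadPlaces L hδ h𝔫), ω v = Set.indicator {p : Fin 3 → v.adicCompletion ↥(maximalRealSubfield L) | p ∈ integralBox ↥(maximalRealSubfield L) (Fin 3) v ∧ ∀ w' : PlacesOver L v,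
              Valued.v (quadraticLocalEquiv L v (IsCMField.complexConj L) hcδ hδ (p 0, p 1) w') ≤ idealRadius L w'.1 𝔫 ∧
              Valued.v (conjLocal L (IsCMField.complexConj L) v (quadraticLocalEquiv L v (IsCMField.complexConj L) hcδ hδ (p 0, p 1)) w') ≤ idealRadius L w'.1 𝔫 ∧
              Valued.v ((toLocalRing L v (p 2) * algebraMap L (LocalRing L v) δ -
                toLocalRing L v 2⁻¹ * (quadraticLocalEquiv L v (IsCMField.complexConj L) hcδ hδ (p 0, p 1) * conjLocal L (IsCMField.complexConj L) v (quadraticLocalEquiv L v (IsCMField.complexConj L) hcδ hδ (p 0, p 1)))) w') ≤ idealRadius L w'.1 𝔫}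
            (fun _ => (1 : ℂ)))
    (hΩ : ∀ x : Fin 3 → FiniteAdeleRing (𝓞 ↥(maximalRealSubfield L)) ↥(maximalRealSubfield L),
      φ₀ (finAdelicToAdelic (↥(maximalRealSubfield L)) L (IsCMField.complexConj L) 3 ((StdForm.antidiagonal 3).over L) (finPart (↥(maximalRealSubfield L)) L (IsCMField.complexConj L) 3 ((StdForm.antidiagonal 3).over L) ((quasiSplit (↥(maximalRealSubfield L)) L (IsCMField.complexConj L) 3).toAdelic (weylLongU ((IsCMField.complexConj L : L ≃ₐ[↥(maximalRealSubfield L)] L) : L →+* L) (rfl : (StdForm.antidiagonal 3).over L = (StdForm.antidiagonal 3).over L)) * (((heisChart hcc (((((0 : InfiniteAdeleRing L)), quadraticFiniteAdeleMap ↥(maximalRealSubfield L) L δ (x 0, x 1)) : AdeleRing (𝓞 L) L), traceZeroLine ↥(maximalRealSubfield L) L (IsCMField.complexConj L) hcδ hδ ((0, x 2) : AdeleRing (𝓞 ↥(maximalRealSubfield L)) ↥(maximalRealSubfield L)))) : ↥(adelicUnipotent ↥(maximalRealSubfield L) L (IsCMField.complexConj L) 3)) : (quasiSplit (↥(maximalRealSubfield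 L)) L (IsCMField.complexConj L) 3).Adelic)) * b₁)) *
        (((detChar (↥(maximalRealSubfield L)) L (IsCMField.complexConj L) h2 hc1 3 ((StdForm.antidiagonal 3).over L) ξ.ψ ξ.hψ (antidiagonal_over_det_ne_zero L 3)) (finAdelicToAdelic (↥(maximalRealSubfield L)) L (IsCMField.complexConj L) 3 ((StdForm.antidiagonal 3).over L) (finPart (↥(maximalRealSubfield L)) L (IsCMField.complexConj L) 3 ((StdForm.antidiagonal 3).over L) ((quasiSplit (↥(maximalRealSubfield L)) L (IsCMField.complexConj L) 3).toAdelic (weylLongU ((IsCMField.complexConj L : L ≃ₐ[↥(maximalRealSubfield L)] L) : L →+* L) (rfl : (StdForm.antidiagonal 3).over L = (StdForm.antidiagonal 3).over L)) * (((heisChart hcc (((((0 : InfiniteAdeleRing L)), quadraticFiniteAdeleMap ↥(maximalRealSubfield L) L δ (x 0, x 1)) : AdeleRing (𝓞 L) L), traceZeroLine ↥(maximalRealSubfield L) L (IsCMField.complexConj L) hcδ hδ ((0, x 2) : AdeleRing (𝓞 ↥(maximalRealSubfield L)) ↥(maximalRealSubfield L)))) : ↥(adelicUnipotent ↥(maximalRealSubfield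 L) L (IsCMField.complexConj L) 3)) : (quasiSplit (↥(maximalRealSubfield L)) L (IsCMField.complexConj L) 3).Adelic)) * b₁)) : ℂˣ) : ℂ) = ∏ᶠ v : HeightOneSpectrum (𝓞 ↥(maximalRealSubfield L)), ω v (fun i => x i v))
    (hin : ∀ z : ℂ, 2 < z.re → ∀ v ∉ (unfoldingBadPlaces L hδ h𝔫), ∀ w : PlacesOver L v, IsCMField.complexConj L • w.1 = w.1 →
        ((Measure.pi fun _ : Fin 3 => νv v) (integralBox ↥(maximalRealSubfield L) (Fin 3) v)).toReal⁻¹ •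
            ∫ p : Fin 3 → v.adicCompletion ↥(maximalRealSubfield L),
              ω v p * (((∏ w' : PlacesOver L v, max 1 (max ((normAbs (w'.1.adicCompletion L) (quadraticLocalEquiv L v (IsCMField.complexConj L) hcδ hδ (p 0, p 1) w') : ℝ≥0) : ℝ)
                ((normAbs (w'.1.adicCompletion L) ((toLocalRing L v (p 2) * algebraMap L (LocalRing L v) δ -
                  toLocalRing L v 2⁻¹ * (quadraticLocalEquiv L v (IsCMField.complexConj L) hcδ hδ (p 0, p 1) *
                    conjLocal L (IsCMField.complexConj L) v (quadraticLocalEquiv L v (IsCMField.complexConj L) hcδ hδ (p 0, p 1)))) w') : ℝ≥0) : ℝ))) : ℝ) : ℂ) ^ (-z)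
              ∂(Measure.pi fun _ : Fin 3 => νv v) =
          (1 - (ξ.bcη⁻¹ * μω).valueAtUniformizer w.1 * (v.residueCard : ℂ) ^ (-(2 * z))) * (1 + (ξ.bcη⁻¹ * μω).valueAtUniformizer w.1 * (v.residueCard : ℂ) ^ (-(2 * z - 1))) /
            ((1 - (ξ.bcη⁻¹ * μω).valueAtUniformizer w.1 * (v.residueCard : ℂ) ^ (-(2 * z - 2))) * (1 + (ξ.bcη⁻¹ * μω).valueAtUniformizer w.1 * (v.residueCard : ℂ) ^ (-(2 * z - 2)))))
    (hsp : ∀ z : ℂ, 2 < z.re → ∀ v ∉ (unfoldingBadPlaces L hδ h𝔫), ∀ w : PlacesOver L v, IsCMField.complexConj L • w.1 ≠ w.1 →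
        ((Measure.pi fun _ : Fin 3 => νv v) (integralBox ↥(maximalRealSubfield L) (Fin 3) v)).toReal⁻¹ •
            ∫ p : Fin 3 → v.adicCompletion ↥(maximalRealSubfield L),
              ω v p * (((∏ w' : PlacesOver L v, max 1 (max ((normAbs (w'.1.adicCompletion L) (quadraticLocalEquiv L v (IsCMField.complexConj L) hcδ hδ (p 0, p 1) w') : ℝ≥0) : ℝ)
                ((normAbs (w'.1.adicCompletion L) ((toLocalRing L v (p 2) * algebraMap L (LocalRing L v) δ -
                  toLocalRing L v 2⁻¹ * (quadraticLocalEquiv L v (IsCMField.complexConj L) hcδ hδ (p 0, p 1) *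
                    conjLocal L (IsCMField.complexConj L) v (quadraticLocalEquiv L v (IsCMField.complexConj L) hcδ hδ (p 0, p 1)))) w') : ℝ≥0) : ℝ))) : ℝ) : ℂ) ^ (-z)
              ∂(Measure.pi fun _ : Fin 3 => νv v) =
          (1 - (ξ.bcη⁻¹ * μω).valueAtUniformizer w.1 * (v.residueCard : ℂ) ^ (-z)) * (1 - (ξ.bcη⁻¹ * μω).valueAtUniformizer (PlacesOver.galInv (IsCMField.complexConj L) w).1 * (v.residueCard : ℂ) ^ (-z)) *
              (1 - (ξ.bcη⁻¹ * μω).valueAtUniformizer w.1 * (ξ.bcη⁻¹ * μω).valueAtUniformizer (PlacesOver.galInv (IsCMField.complexConj L) w).1 * (v.residueCard : ℂ) ^ (-(2 * z - 1))) /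
            ((1 - (ξ.bcη⁻¹ * μω).valueAtUniformizer w.1 * (v.residueCard : ℂ) ^ (-(z - 1))) * (1 - (ξ.bcη⁻¹ * μω).valueAtUniformizer (PlacesOver.galInv (IsCMField.complexConj L) w).1 * (v.residueCard : ℂ) ^ (-(z - 1))) *
              (1 - (ξ.bcη⁻¹ * μω).valueAtUniformizer w.1 * (ξ.bcη⁻¹ * μω).valueAtUniformizer (PlacesOver.galInv (IsCMField.complexConj L) w).1 * (v.residueCard : ℂ) ^ (-(2 * z - 2))))) :
    ∀ z : ℂ, 2 < z.re → (∫ v : ↥(adelicUnipotent (↥(maximalRealSubfield L)) L (IsCMField.complexConj L) 3), flatSectionU φ₀ z ((quasiSplit (↥(maximalRealSubfield L)) L (IsCMField.complexConj L) 3).toAdelic (weylLongU ((IsCMField.complexConj L : L ≃ₐ[↥(maximalRealSubfield L)] L) : L →+* L) (rfl : (StdForm.antidiagonal 3).over L = (StdForm.antidiagonal 3).over L)) * ((v : (quasiSplit (↥(maximalRealSubfield L)) L (IsCMField.complexConj L) 3).Adelic) * (finAdelicToAdelic (↥(maximalRealSubfield L)) L (IsCMField.complexConj L) 3 ((StdForm.antidiagonal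 3).over L) b₁))) ∂ν) * (((borelHeight (finAdelicToAdelic (↥(maximalRealSubfield L)) L (IsCMField.complexConj L) 3 ((StdForm.antidiagonal 3).over L) b₁) : ℝ) : ℂ) ^ (z - 2)) *
        (((detChar (↥(maximalRealSubfield L)) L (IsCMField.complexConj L) h2 hc1 3 ((StdForm.antidiagonal 3).over L) ξ.ψ ξ.hψ (antidiagonal_over_det_ne_zero L 3)) (finAdelicToAdelic (↥(maximalRealSubfield L)) L (IsCMField.complexConj L) 3 ((StdForm.antidiagonal 3).over L) b₁) : ℂˣ) : ℂ) = (fun z : ℂ => (((unfoldingHaarConst L hcc hcδ hδ hd ν h𝓕N μE μE₁ μE₂ μF μF₁ μF₂ νv hφu (isUnitary_quadraticHeckeCharCM_mul_self L) (bcηInv_mul_ideleBaseChange_eq L ξ hμω) : ℝ) : ℂ) * ∏ v ∈ (unfoldingBadPlaces L hδ h𝔫), ((Measure.pi fun _ : Fin 3 => νv v) (integralBox ↥(maximalRealSubfield L) (Fin 3) v)).toReal⁻¹ •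
              ∫ p : Fin 3 → v.adicCompletion ↥(maximalRealSubfield L),
                Set.indicator {p : Fin 3 → v.adicCompletion ↥(maximalRealSubfield L) | p ∈ integralBox ↥(maximalRealSubfield L) (Fin 3) v ∧ ∀ w' : PlacesOver L v,
                    Valued.v (quadraticLocalEquiv L v (IsCMField.complexConj L) hcδ hδ (p 0, p 1) w') ≤ idealRadius L w'.1 𝔫 ∧
                    Valued.v (conjLocal L (IsCMField.complexConj L) v (quadraticLocalEquiv L v (IsCMField.complexConj L) hcδ hδ (p 0, p 1)) w') ≤ idealRadius L w'.1 𝔫 ∧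
                    Valued.v ((toLocalRing L v (p 2) * algebraMap L (LocalRing L v) δ -
                      toLocalRing L v 2⁻¹ * (quadraticLocalEquiv L v (IsCMField.complexConj L) hcδ hδ (p 0, p 1) * conjLocal L (IsCMField.complexConj L) v (quadraticLocalEquiv L v (IsCMField.complexConj L) hcδ hδ (p 0, p 1)))) w') ≤ idealRadius L w'.1 𝔫}
                  (fun _ => (1 : ℂ)) p *
                (((∏ w' : PlacesOver L v, max 1 (max ((normAbs (w'.1.adicCompletion L) (quadraticLocalEquiv L v (IsCMField.complexConj L) hcδ hδ (p 0, p 1) w') : ℝ≥0) : ℝ)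
                  ((normAbs (w'.1.adicCompletion L) ((toLocalRing L v (p 2) * algebraMap L (LocalRing L v) δ -
                    toLocalRing L v 2⁻¹ * (quadraticLocalEquiv L v (IsCMField.complexConj L) hcδ hδ (p 0, p 1) *
                      conjLocal L (IsCMField.complexConj L) v (quadraticLocalEquiv L v (IsCMField.complexConj L) hcδ hδ (p 0, p 1)))) w') : ℝ≥0) : ℝ))) : ℝ) : ℂ) ^ (-z) ∂(Measure.pi fun _ : Fin 3 => νv v)) *
            ∫ Xi : InfiniteAdeleRing L, ∫ a : InfiniteAdeleRing ↥(maximalRealSubfield L),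
            (∏ w : InfinitePlace L, unfoldingArchPhase L ξ w * archUnitaryValue (kμ w - 2 * ξ.eη w) 0 ((((-(1 + ‖Xi w‖ ^ 2 / 2)) : ℝ) : ℂ) + (((w.embedding δ).im * ((InfiniteAdeleRing.ringEquiv_mixedSpace ↥(maximalRealSubfield L)) a).1 ⟨w.comap (algebraMap ↥(maximalRealSubfield L) L), Summit.HodgeConjecture.HodgeConjecture.Cruxes.H413.K2E1HeightBigCellLineFormulaU2.isReal_comap_maximalRealSubfield L w⟩ : ℝ) : ℂ) * Complex.I) * (((2 : ℂ) + ((((-(1 + ‖Xi w‖ ^ 2 / 2)) : ℝ) : ℂ) + (((w.embedding δ).im * ((InfiniteAdeleRing.ringEquiv_mixedSpace ↥(maximalRealSubfield L)) a).1 ⟨w.comap (algebraMap ↥(maximalRealSubfield L) L), Summit.HodgeConjecture.HodgeConjecture.Cruxes.H413.K2E1HeightBigCellLineFormulaU2.isReal_comap_maximalRealSubfield L w⟩ : ℝ) : ℂ) * Complex.I)) / ((((-(1 + ‖Xi w‖ ^ 2 / 2)) : ℝ) : ℂ) + (((w.embedding δ).im * ((InfiniteAdeleRing.ringEquiv_mixedSpace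 ↥(maximalRealSubfield L)) a).1 ⟨w.comap (algebraMap ↥(maximalRealSubfield L) L), Summit.HodgeConjecture.HodgeConjecture.Cruxes.H413.K2E1HeightBigCellLineFormulaU2.isReal_comap_maximalRealSubfield L w⟩ : ℝ) : ℂ) * Complex.I)) ^ (((kμ w - 2 * ξ.eη w) - 1) / 2).toNat * (((2 : ℂ) + conj ((((-(1 + ‖Xi w‖ ^ 2 / 2)) : ℝ) : ℂ) + (((w.embedding δ).im * ((InfiniteAdeleRing.ringEquiv_mixedSpace ↥(maximalRealSubfield L)) a).1 ⟨w.comap (algebraMap ↥(maximalRealSubfield L) L), Summit.HodgeConjecture.HodgeConjecture.Cruxes.H413.K2E1HeightBigCellLineFormulaU2.isReal_comap_maximalRealSubfield L w⟩ : ℝ) : ℂ) * Complex.I)) / conj ((((-(1 + ‖Xi w‖ ^ 2 / 2)) : ℝ) : ℂ) + (((w.embedding δ).im * ((InfiniteAdeleRing.ringEquiv_mixedSpace ↥(maximalRealSubfield L)) a).1 ⟨w.comap (algebraMap ↥(maximalRealSubfield L) L), Summit.HodgeConjecture.HodgeConjecture.Cruxes.H413.K2E1HeightBigCellLineFormulaU2.isReal_comap_maximalRealSubfield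 L w⟩ : ℝ) : ℂ) * Complex.I)) ^ ((-(kμ w - 2 * ξ.eη w) - 1) / 2).toNat) *
              ((((∏ w : InfinitePlace L, ((1 + ‖(Xi) w‖ ^ 2 / 2) ^ 2 + (w δ) ^ 2 * (((InfiniteAdeleRing.ringEquiv_mixedSpace ↥(maximalRealSubfield L)) a).1 ⟨w.comap (algebraMap ↥(maximalRealSubfield L) L), Summit.HodgeConjecture.HodgeConjecture.Cruxes.H413.K2E1HeightBigCellLineFormulaU2.isReal_comap_maximalRealSubfield L w⟩) ^ 2))) : ℝ) : ℂ) ^ (-z) ∂μF₁ ∂μE₁) z *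
          ((partialStandardL {w : HeightOneSpectrum (𝓞 L) | w.under (𝓞 ↥(maximalRealSubfield L)) ∈ (↑(unfoldingBadPlaces L hδ h𝔫) : Set (HeightOneSpectrum (𝓞 ↥(maximalRealSubfield L))))} (fun w => {(ξ.bcη⁻¹ * μω).valueAtUniformizer w}) (z - 1) * partialStandardL (↑(unfoldingBadPlaces L hδ h𝔫) : Set (HeightOneSpectrum (𝓞 ↥(maximalRealSubfield L)))) (fun v => {(1 : HeckeCharacter ↥(maximalRealSubfield L)).valueAtUniformizer v}) (2 * z - 2)) /
            (partialStandardL {w : HeightOneSpectrum (𝓞 L) | w.under (𝓞 ↥(maximalRealSubfield L)) ∈ (↑(unfoldingBadPlaces L hδ h𝔫) : Set (HeightOneSpectrum (𝓞 ↥(maximalRealSubfield L))))} (fun w => {(ξ.bcη⁻¹ * μω).valueAtUniformizer w}) z * partialStandardL (↑(unfoldingBadPlaces L hδ h𝔫) : Set (HeightOneSpectrum (𝓞 ↥(maximalRealSubfield L)))) (fun v => {(1 : HeckeCharacter ↥(maximalRealSubfield L)).valueAtUniformizer v}) (2 * z - 1))) :=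
  hsrc16_of_coreLetters_at L hcc h2 hc1 hcδ hδ hd ν h𝓕N h𝓕c h𝓕1 μE μE₁ μE₂ μF μF₁ μF₂ νv ξ hφu hμω hμ hm1 hφ₀V hφ₀c hφ₀M Ec₀ hEis₀ hb₁ 𝔫
    (unfoldingBadPlaces L hδ h𝔫) (hgood_unfoldingBadPlaces L hδ h𝔫 (ξ.bcη⁻¹ * μω) hφ𝔫) ω hωc hω1 hωS₀ hΩ hin hsp

end Summit.HodgeConjecture.HodgeConjecture.R90.S8

end
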